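import Summits.ResolutionOfSingularities.ResolutionOfSingularities.Theorems.FrobeniusLadderFRationalResolutionEtaleChartStalkBlowup
import Summits.ResolutionOfSingularities.ResolutionOfSingularities.Theorems.FrobeniusLadderFRationalResolutionCompletedBaseChangeFibreDown
import Summits.ResolutionOfSingularities.ResolutionOfSingularities.Theorems.FrobeniusLadderFRationalResolutionCompletedBaseChangeFibreDownFinite
import Summits.ResolutionOfSingularities.ResolutionOfSingularities.Theorems.FrobeniusLadderFRationalResolutionCompletedBaseChangeFibreTransport
import Summits.ResolutionOfSingularities.ResolutionOfSingularities.Theorems.FrobeniusLadderFRationalResolutionEtaleBlowupComparison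
import Summits.ResolutionOfSingularities.ResolutionOfSingularities.Theorems.FrobeniusLadderFRationalResolutionBlowupRegularOffCentre
import Summits.ResolutionOfSingularities.ResolutionOfSingularities.Theorems.FrobeniusLadderFRationalResolutionTwoStepHloc
import Literature.AlgebraicGeometry.Resolution.AffineBlowupIntegral
import HarnessLib

/-!
# Crux `FrobeniusLadder.FRationalResolution` (stmt-ResolutionOfSingularities-15317), line `redirect`,
# stub `stub_diagonalizableQuotientResolution` — **THE TWO-STEP ÉTALE DESCENT (ε)** of MEMO-15317-leafhand2-g23 §3:
# `hloc` at an isolated singular point from an étale chart whose STALK has a point blow-up (or `𝔪^{a+1}`-blow-up) with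
# FINITELY MANY singular points, each resolved by ONE further point blow-up

The one-step files `…EtaleChartStalkBlowup` (p840894) / `…EtaleChartStalkBlowupPow` treat the datum «`Bl_{𝔪^{a+1}}(Spec 𝒪_{Y,y})`
regular». This file treats the TWO-STEP datum «`X₁' = Bl_{𝔪^{a+1}}(Spec 𝒪_{Y,y})` has finitely many singular points and
`Bl_{𝔪_w}(Spec 𝒪_{X₁',w})` is regular at each of them», which is what the naive two-step recipe produces at a twisted isolated
diagonalizable-quotient point (consumer `…SingularPointsFinite.hloc_of_maximalIdealPow_then_finite_singularPoints` in the Galois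
presentation; this file removes the Galois presentation: any étale neighbourhood `(Y, y) → (X, x)` will do).

Assembly (all bricks in tree):
* extraction of ring data (`U = Spec B ∋ x` affine with `x ↔ 𝔭` the only singular point, `V = Spec C ∋ y` affine over `U`,
  `B → C` étale, `y ↔ 𝔔` over `𝔭`, `𝔭 C_𝔔 = 𝔪_{C_𝔔}`, `𝒪_{Y,y} ≅ C_𝔔`) exactly as in `…EtaleChartStalkBlowupPow`;
* `isMaximal_of_isUnramifiedAt_of_comap_eq` — `𝔔` is MAXIMAL (a prime of an unramified essentially-finite-type algebra over a
  maximal ideal is maximal: `𝔔 ⊆ 𝔐` maximal ⇒ `𝔔 C_𝔐 ⊇ 𝔭 C_𝔐 = 𝔐 C_𝔐`);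
* transport of the datum along `𝒪_{Y,y} ≅ C_𝔔` (`…CompletedBaseChangeFibreTransport.hfin_hloc_of_ringEquiv`), centre
  `𝔪^{a+1} ↦ (𝔭^{a+1} C) C_𝔔`;
* DOWN to `Bl_{𝔭^{a+1} C}(Spec C)` over `V(𝔔)` (`…CompletedBaseChangeFibreDown.hloc_stalk_down`,
  `…CompletedBaseChangeFibreDownFinite.finite_singular_over_of_finite_localization`);
* the étale comparison `Φ : Bl_{𝔭^{a+1} C}(Spec C) → X₁ = Bl_{𝔭^{a+1}}(Spec B)` (`…EtaleBlowupComparison.exists_etale_comparison`):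
  every singular point of `X₁` lies over `𝔭` (`…BlowupRegularOffCentre`), lifts along `Φ` to a singular point over `𝔔`, so
  `Sing X₁` is finite and each of its points is resolved étale-locally by ONE point blow-up of a stalk — the one-step
  `…EtaleChartStalkBlowup.hloc_of_etale_chart_stalkBlowup` ON `X₁` (integral, locally of finite type over `k`);
* conclusion by `…TwoStepHloc.hloc_of_two_step_affineOpen`.

* ★ `hloc_of_two_step_etale_ring_data` — ring-data form;
* ★★ `hloc_of_etale_chart_two_step` — scheme form (`φ : Y → X` étale, `x = φ y`);
* ★★ `hasResolution_of_isolated_etale_two_step` — if every singular point is of this kind, `X` has a resolution.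

Honest label: plumbing toward ONE leaf stub (no stub, crux or summit closed). No definitions, no named facts, no sorry.
[folklore; cite: Kollar2007, §2.2] [cite: Matsumura1987, Thm. 23.7] [cite: StacksProject, Tag 02GU; Tag 0804]
-/

noncomputable section

-- single-problem summit: the doubled namespace component is forced
set_option linter.dupNamespace false

open CategoryTheory AlgebraicGeometry TopologicalSpace IsLocalRing
open Literature.AlgebraicGeometry.Resolution

namespace Summit.ResolutionOfSingularities.ResolutionOfSingularities.Theorems.FRationalResolution.EtaleChartTwoStep

/-! ## §1 A prime of an unramified algebra over a maximal ideal is maximal -/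

/-- **A prime `𝔔` of an essentially-finite-type `R`-algebra `C`, unramified at the primes above `𝔔`, lying over a MAXIMAL
ideal `𝔭` of `R` is maximal**: if `𝔔 ⊆ 𝔐` with `𝔐` maximal then `𝔐 ∩ R = 𝔭`, `𝔭 C_𝔐 = 𝔐 C_𝔐` (unramified at `𝔐`), so the prime
`𝔔 C_𝔐 ⊇ 𝔭 C_𝔐` equals `𝔐 C_𝔐` and `𝔔 = 𝔐`. [cite: StacksProject, Tag 02GU] [folklore] -/
theorem isMaximal_of_formallyUnramified_of_comap_eq {R C : Type} [CommRing R] [CommRing C] [Algebra R C]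
    [Algebra.FormallyUnramified R C] [Algebra.EssFiniteType R C]
    (𝔭 : Ideal R) [h𝔭 : 𝔭.IsMaximal] (𝔔 : Ideal C) [h𝔔 : 𝔔.IsPrime]
    (h : 𝔔.comap (algebraMap R C) = 𝔭) : 𝔔.IsMaximal := by
  obtain ⟨𝔐, h𝔐max, h𝔔𝔐⟩ := Ideal.exists_le_maximal 𝔔 h𝔔.ne_top
  -- `𝔐 ∩ R = 𝔭`
  have h𝔐c : 𝔐.comap (algebraMap R C) = 𝔭 := by
    refine (h𝔭.eq_of_le ?_ ?_).symm
    · exact Ideal.comap_ne_top _ h𝔐max.ne_top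
    · rw [← h]; exact Ideal.comap_mono h𝔔𝔐
  haveI : 𝔐.LiesOver 𝔭 := ⟨h𝔐c.symm⟩
  -- unramified at `𝔐`: `𝔭 C_𝔐 = 𝔐 C_𝔐`
  have hunr : 𝔭.map (algebraMap R (Localization.AtPrime 𝔐)) = maximalIdeal (Localization.AtPrime 𝔐) := by
    letI := Localization.AtPrime.algebraOfLiesOver 𝔭 𝔐
    haveI : Algebra.IsUnramifiedAt R 𝔐 :=
      (Algebra.formallyUnramified_iff_forall).mp inferInstance ⟨𝔐, h𝔐max.isPrime⟩
    exact ((Algebra.isUnramifiedAt_iff_map_eq R 𝔭 𝔐).mp inferInstance).2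
  -- the prime `𝔔 C_𝔐` contains `𝔭 C_𝔐 = 𝔐 C_𝔐`
  have hdisj : Disjoint ((𝔐.primeCompl : Submonoid C) : Set C) (𝔔 : Set C) :=
    Set.disjoint_left.mpr fun x hx hx' => hx (h𝔔𝔐 hx')
  haveI h𝔔' : (𝔔.map (algebraMap C (Localization.AtPrime 𝔐))).IsPrime :=
    IsLocalization.isPrime_of_isPrime_disjoint 𝔐.primeCompl _ 𝔔 h𝔔 hdisj
  have hle : maximalIdeal (Localization.AtPrime 𝔐) ≤ 𝔔.map (algebraMap C (Localization.AtPrime 𝔐)) := by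
    rw [← hunr, IsScalarTower.algebraMap_eq R C (Localization.AtPrime 𝔐), ← Ideal.map_map]
    exact Ideal.map_mono (Ideal.map_le_iff_le_comap.mpr h.ge)
  have heq : 𝔔.map (algebraMap C (Localization.AtPrime 𝔐)) = maximalIdeal (Localization.AtPrime 𝔐) :=
    ((IsLocalRing.maximalIdeal.isMaximal _).eq_of_le h𝔔'.ne_top hle).symm
  -- contract: `𝔔 = 𝔐`
  have h𝔔𝔐' : 𝔔 = 𝔐 := by
    have h1 : (𝔔.map (algebraMap C (Localization.AtPrime 𝔐))).comap (algebraMap C (Localization.AtPrime 𝔐)) = 𝔔 :=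
      IsLocalization.under_map_of_isPrime_disjoint 𝔐.primeCompl (Localization.AtPrime 𝔐) h𝔔 hdisj
    rw [← h1, heq]
    exact Localization.AtPrime.under_maximalIdeal
  rw [h𝔔𝔐']
  exact h𝔐max


/-! ## §2 Ring-data form -/

/-- ★ **Two-step étale descent, ring-data form.** `X` integral, locally of finite type over a field `k`; `ι : Spec B → X` an
affine open (`B` a domain of finite type over `k`) through the singular point `x = ι 𝔭`, `𝔭` maximal, `≠ 0`, all other points
of `Spec B` regular; `C` an ÉTALE `B`-algebra with a prime `𝔔` over `𝔭`. If `Bl_{(𝔭^{a+1}C) C_𝔔}(Spec C_𝔔)` (`= Bl_{𝔪^{a+1}}(Spec C_𝔔)`)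
has finitely many singular points and `Bl_{𝔪_w}(Spec 𝒪_w)` is regular at each of them, then `x` carries the local resolution datum
`hloc` of `…IsolatedGlue`. [cite: Kollar2007, §2.2] [cite: Matsumura1987, Thm. 23.7] [cite: StacksProject, Tag 0804] -/
theorem hloc_of_two_step_etale_ring_data (k : Type) [Field k] (X : Scheme.{0}) [IsIntegral X]
    (f : X ⟶ Spec (.of k)) [LocallyOfFiniteType f]
    {B C : Type} [CommRing B] [CommRing C] [IsDomain B] [Algebra k B] [Algebra.FiniteType k B]
    [Algebra B C] [Algebra.Etale B C]
    (ι : Spec (.of B) ⟶ X) [IsOpenImmersion ι] (hι : ι ≫ f = Spec.map (CommRingCat.ofHom (algebraMap k B)))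
    (𝔭 : Ideal B) [h𝔭 : 𝔭.IsMaximal] (h𝔭0 : 𝔭 ≠ ⊥)
    (hsing : ι ⟨𝔭, h𝔭.isPrime⟩ ∉ Scheme.regularLocus X)
    (hregB : ∀ P : Spec (.of B), P.asIdeal ≠ 𝔭 → P ∈ Scheme.regularLocus (Spec (.of B)))
    (𝔔 : Ideal C) [h𝔔 : 𝔔.IsPrime] (h𝔔𝔭 : 𝔔.comap (algebraMap B C) = 𝔭) (a : ℕ)
    (hfin' : (Scheme.regularLocus (affineBlowup (((𝔭 ^ (a + 1)).map (algebraMap B C)).map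
      (algebraMap C (Localization.AtPrime 𝔔)))))ᶜ.Finite)
    (hloc' : ∀ w ∈ (Scheme.regularLocus (affineBlowup (((𝔭 ^ (a + 1)).map (algebraMap B C)).map
      (algebraMap C (Localization.AtPrime 𝔔)))))ᶜ,
      Scheme.IsRegular (affineBlowup (maximalIdeal ((affineBlowup (((𝔭 ^ (a + 1)).map (algebraMap B C)).map
        (algebraMap C (Localization.AtPrime 𝔔)))).presheaf.stalk w)))) :
    ∃ (V : X.Opens), ι ⟨𝔭, h𝔭.isPrime⟩ ∈ V ∧
      (∀ t : X, t ∉ Scheme.regularLocus X → t ∈ V → t = ι ⟨𝔭, h𝔭.isPrime⟩) ∧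
      ∃ (Y : Scheme.{0}) (ρ : Y ⟶ V), IsProper ρ ∧ Scheme.IsRegular Y ∧
        IsIso (ρ ∣_ (V.ι ⁻¹ᵁ ⟨Scheme.regularLocus X, isOpen_regularLocus_of_locallyOfFiniteType_field f⟩)) ∧
        Dense ((ρ ⁻¹ᵁ (V.ι ⁻¹ᵁ ⟨Scheme.regularLocus X,
          isOpen_regularLocus_of_locallyOfFiniteType_field f⟩) : Y.Opens) : Set Y) := by
  classical
  haveI : IsNoetherianRing B := Algebra.FiniteType.isNoetherianRing k B
  haveI : Algebra.FiniteType B C := inferInstance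
  haveI : IsNoetherianRing C := Algebra.FiniteType.isNoetherianRing B C
  -- `𝔔` is maximal
  haveI h𝔔max : 𝔔.IsMaximal := isMaximal_of_formallyUnramified_of_comap_eq 𝔭 𝔔 h𝔔𝔭
  -- `C` is of finite type over `k`
  letI : Algebra k C := ((algebraMap B C).comp (algebraMap k B)).toAlgebra
  haveI : IsScalarTower k B C := IsScalarTower.of_algebraMap_eq (fun _ => rfl)
  haveI : Algebra.FiniteType k C := Algebra.FiniteType.trans (S := B) inferInstance inferInstance
  -- the centre `𝔭^{a+1}` and generators of `𝔭^{a+1} C`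
  have hI0 : 𝔭 ^ (a + 1) ≠ ⊥ := pow_ne_zero _ h𝔭0
  have hI𝔭 : 𝔭 ^ (a + 1) ≤ 𝔭 := Ideal.pow_le_self (Nat.succ_ne_zero a)
  obtain ⟨n, x, hx⟩ := Submodule.fg_iff_exists_fin_generating_family.mp (IsNoetherian.noetherian (𝔭 ^ (a + 1)))
  have hIC : (𝔭 ^ (a + 1)).map (algebraMap B C) = Ideal.span (Set.range ((algebraMap B C) ∘ x)) := by
    rw [← hx, Ideal.submodule_span_eq, Ideal.map_span, ← Set.range_comp]
  -- DOWN: the datum on `Bl_{𝔭^{a+1} C}(Spec C)` over `V(𝔔)`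
  have hdown_loc : ∀ z : affineBlowup ((𝔭 ^ (a + 1)).map (algebraMap B C)),
      𝔔 ≤ (affineBlowup.π ((𝔭 ^ (a + 1)).map (algebraMap B C)) z).asIdeal →
      ¬ IsRegularLocalRing ((affineBlowup ((𝔭 ^ (a + 1)).map (algebraMap B C))).presheaf.stalk z) →
      Scheme.IsRegular (affineBlowup (R := (affineBlowup ((𝔭 ^ (a + 1)).map (algebraMap B C))).presheaf.stalk z)
        (maximalIdeal _)) :=
    fun z hz𝔔 hz => CompletedBaseChangeFibreDown.hloc_stalk_down k C 𝔔 ((algebraMap B C) ∘ x)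
      ((𝔭 ^ (a + 1)).map (algebraMap B C)) hIC
      (fun w hw => hloc' w hw) z hz𝔔 hz
  have hdown_fin : {z : affineBlowup ((𝔭 ^ (a + 1)).map (algebraMap B C)) |
      𝔔 ≤ (affineBlowup.π ((𝔭 ^ (a + 1)).map (algebraMap B C)) z).asIdeal ∧
        ¬ IsRegularLocalRing ((affineBlowup ((𝔭 ^ (a + 1)).map (algebraMap B C))).presheaf.stalk z)}.Finite :=
    CompletedBaseChangeFibreDownFinite.finite_singular_over_of_finite_localization k C 𝔔
      ((algebraMap B C) ∘ x) ((𝔭 ^ (a + 1)).map (algebraMap B C)) hIC hfin'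
  -- the blow-up `X₁ = Bl_{𝔭^{a+1}}(Spec B)` and the étale comparison `Φ`
  obtain ⟨f₁, hf₁⟩ : ∃ f₁ : affineBlowup (𝔭 ^ (a + 1)) ⟶ Spec (.of k),
      f₁ = affineBlowup.π (𝔭 ^ (a + 1)) ≫ Spec.map (CommRingCat.ofHom (algebraMap k B)) := ⟨_, rfl⟩
  haveI : LocallyOfFiniteType (Spec.map (CommRingCat.ofHom (algebraMap k B))) := by
    rw [HasRingHomProperty.Spec_iff (P := @LocallyOfFiniteType), CommRingCat.hom_ofHom]
    exact RingHom.finiteType_algebraMap.mpr inferInstance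
  haveI : LocallyOfFiniteType f₁ := by rw [hf₁]; infer_instance
  haveI : IsIntegral (affineBlowup (𝔭 ^ (a + 1))) := affineBlowup.isIntegral hI0
  have hopen₁ : IsOpen (Scheme.regularLocus (affineBlowup (𝔭 ^ (a + 1)))) :=
    isOpen_regularLocus_of_locallyOfFiniteType_field f₁
  have hopenB : IsOpen (Scheme.regularLocus (Spec (.of B))) :=
    isOpen_regularLocus_of_locallyOfFiniteType_field (Spec.map (CommRingCat.ofHom (algebraMap k B)))
  have hφet : (algebraMap B C).Etale := RingHom.etale_algebraMap.mpr inferInstance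
  obtain ⟨Φ, hΦet, -, hΦreg, hΦsurj⟩ :=
    EtaleBlowupComparison.exists_etale_comparison (algebraMap B C) hφet (𝔭 ^ (a + 1))
  haveI := hΦet
  have hz𝔔 : Spec.map (CommRingCat.ofHom (algebraMap B C)) (⟨𝔔, h𝔔⟩ : Spec (.of C)) = ⟨𝔭, h𝔭.isPrime⟩ :=
    PrimeSpectrum.ext h𝔔𝔭
  -- every singular point of `X₁` lies over `𝔭` and lifts along `Φ` to a singular point over `𝔔`
  have hclass : ∀ z₁ : affineBlowup (𝔭 ^ (a + 1)), z₁ ∉ Scheme.regularLocus (affineBlowup (𝔭 ^ (a + 1))) →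
      ∃ z' : affineBlowup ((𝔭 ^ (a + 1)).map (algebraMap B C)), Φ z' = z₁ ∧
        𝔔 ≤ (affineBlowup.π ((𝔭 ^ (a + 1)).map (algebraMap B C)) z').asIdeal ∧
        ¬ IsRegularLocalRing ((affineBlowup ((𝔭 ^ (a + 1)).map (algebraMap B C))).presheaf.stalk z') := by
    intro z₁ hz₁
    have hover : 𝔭 ^ (a + 1) ≤ (affineBlowup.π (𝔭 ^ (a + 1)) z₁).asIdeal := by
      by_contra hnot
      apply hz₁
      refine BlowupRegularOffCentre.preimage_iSup_le_regularLocus (𝔭 ^ (a + 1)) hopen₁ hopenB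
        (fun P hP => hregB P ?_) z₁ ?_
      · intro heq
        apply hP
        rw [heq]
        exact hI𝔭
      · obtain ⟨b, hbI, hbz⟩ := SetLike.not_le_iff_exists.mp hnot
        exact Opens.mem_iSup.mpr ⟨⟨b, hbI⟩, (PrimeSpectrum.mem_basicOpen _ _).mpr hbz⟩
    have h𝔭le : 𝔭 ≤ (affineBlowup.π (𝔭 ^ (a + 1)) z₁).asIdeal := Ideal.IsPrime.le_of_pow_le hover
    have hπz₁ : affineBlowup.π (𝔭 ^ (a + 1)) z₁ = ⟨𝔭, h𝔭.isPrime⟩ :=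
      PrimeSpectrum.ext ((h𝔭.eq_of_le (affineBlowup.π (𝔭 ^ (a + 1)) z₁).isPrime.ne_top h𝔭le).symm)
    obtain ⟨z', hz'z, hz'π⟩ := hΦsurj z₁ ⟨𝔔, h𝔔⟩ (by rw [hπz₁, hz𝔔])
    refine ⟨z', hz'z, ?_, ?_⟩
    · rw [hz'π]
    · intro hreg
      apply hz₁
      rw [← hz'z]
      exact (hΦreg z').mp hreg
  -- `Sing X₁` is finite
  have hfin₁ : (Scheme.regularLocus (affineBlowup (𝔭 ^ (a + 1))))ᶜ.Finite := by
    refine (hdown_fin.image Φ).subset ?_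
    intro z₁ hz₁
    obtain ⟨z', hz'z, hz'𝔔, hz's⟩ := hclass z₁ hz₁
    exact ⟨z', ⟨hz'𝔔, hz's⟩, hz'z⟩
  -- `hloc` at every singular point of `X₁`: one-step étale descent along `Φ`
  have hloc₁ : ∀ z₁ : affineBlowup (𝔭 ^ (a + 1)), z₁ ∉ Scheme.regularLocus (affineBlowup (𝔭 ^ (a + 1))) →
      ∃ (V : (affineBlowup (𝔭 ^ (a + 1))).Opens), z₁ ∈ V ∧
        (∀ t : affineBlowup (𝔭 ^ (a + 1)), t ∉ Scheme.regularLocus (affineBlowup (𝔭 ^ (a + 1))) → t ∈ V → t = z₁) ∧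
        ∃ (Y' : Scheme.{0}) (ρ' : Y' ⟶ V), IsProper ρ' ∧ Scheme.IsRegular Y' ∧
          IsIso (ρ' ∣_ (V.ι ⁻¹ᵁ ⟨Scheme.regularLocus (affineBlowup (𝔭 ^ (a + 1))), hopen₁⟩)) ∧
          Dense ((ρ' ⁻¹ᵁ (V.ι ⁻¹ᵁ ⟨Scheme.regularLocus (affineBlowup (𝔭 ^ (a + 1))), hopen₁⟩) : Y'.Opens) :
            Set Y') := by
    intro z₁ hz₁
    obtain ⟨z', hz'z, hz'𝔔, hz's⟩ := hclass z₁ hz₁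
    have hbl := hdown_loc z' hz'𝔔 hz's
    have hx₁ : Φ z' ∉ Scheme.regularLocus (affineBlowup (𝔭 ^ (a + 1))) := by rw [hz'z]; exact hz₁
    have key := EtaleChartStalkBlowup.hloc_of_etale_chart_stalkBlowup k (affineBlowup (𝔭 ^ (a + 1))) f₁ hfin₁ Φ z'
      hx₁ hbl
    rw [hz'z] at key
    exact key
  -- conclude by the two-step model on `Spec B`
  have hsingB : (⟨𝔭, h𝔭.isPrime⟩ : Spec (.of B)) ∉ Scheme.regularLocus (Spec (.of B)) :=
    fun hreg => hsing ((mem_regularLocus_iff_of_flat_of_isPreimmersion ι _).mp hreg)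
  have hRegI : ∀ P : Spec (.of B), P ∈ Scheme.regularLocus (Spec (.of B)) ↔ ¬ 𝔭 ^ (a + 1) ≤ P.asIdeal := by
    intro P
    constructor
    · intro hP hle
      have : P = ⟨𝔭, h𝔭.isPrime⟩ :=
        PrimeSpectrum.ext (h𝔭.eq_of_le P.isPrime.ne_top (Ideal.IsPrime.le_of_pow_le hle)).symm
      rw [this] at hP
      exact hsingB hP
    · intro hnle
      refine hregB P (fun heq => hnle ?_)
      rw [heq]
      exact hI𝔭
  have hq : ∀ t : Spec (.of B), 𝔭 ^ (a + 1) ≤ t.asIdeal → t = ⟨𝔭, h𝔭.isPrime⟩ := fun t ht =>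
    PrimeSpectrum.ext (h𝔭.eq_of_le t.isPrime.ne_top (Ideal.IsPrime.le_of_pow_le ht)).symm
  exact TwoStepHloc.hloc_of_two_step_affineOpen k X f B ι hι (𝔭 ^ (a + 1)) (IsNoetherian.noetherian _) hI0 hRegI
    ⟨𝔭, h𝔭.isPrime⟩ hq hopen₁ hfin₁ hloc₁

/-! ## §3 Scheme form -/

/-- ★★ **TWO-STEP ÉTALE DESCENT.** `X` integral, locally of finite type over a field `k`, with finite singular locus;
`φ : Y → X` étale, `x = φ y` singular. If `X₁' = Bl_{𝔪^{a+1}}(Spec 𝒪_{Y,y})` has finitely many singular points and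
`Bl_{𝔪_w}(Spec 𝒪_{X₁',w})` is regular at each of them, then `x` has an open neighbourhood `W` containing no other singular point and
a proper `ρ : Z → W`, `Z` regular, an isomorphism over `W ∩ Reg X` with dense preimage. [cite: Kollar2007, §2.2]
[cite: Matsumura1987, Thm. 23.7] [cite: StacksProject, Tag 02GU; Tag 0804] -/
theorem hloc_of_etale_chart_two_step (k : Type) [Field k] (X : Scheme.{0}) [IsIntegral X]
    (f : X ⟶ Spec (.of k)) [LocallyOfFiniteType f] (hfin : (Scheme.regularLocus X)ᶜ.Finite)
    {Y : Scheme.{0}} (φ : Y ⟶ X) [Etale φ] (y : Y) (hx : φ y ∉ Scheme.regularLocus X) (a : ℕ)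
    (hfin' : (Scheme.regularLocus (affineBlowup ((maximalIdeal (Y.presheaf.stalk y)) ^ (a + 1))))ᶜ.Finite)
    (hloc' : ∀ w ∈ (Scheme.regularLocus (affineBlowup ((maximalIdeal (Y.presheaf.stalk y)) ^ (a + 1))))ᶜ,
      Scheme.IsRegular (affineBlowup (maximalIdeal
        ((affineBlowup ((maximalIdeal (Y.presheaf.stalk y)) ^ (a + 1))).presheaf.stalk w)))) :
    ∃ (W : X.Opens), φ y ∈ W ∧ (∀ t : X, t ∉ Scheme.regularLocus X → t ∈ W → t = φ y) ∧
      ∃ (Z : Scheme.{0}) (ρ : Z ⟶ W), IsProper ρ ∧ Scheme.IsRegular Z ∧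
        IsIso (ρ ∣_ (W.ι ⁻¹ᵁ ⟨Scheme.regularLocus X, isOpen_regularLocus_of_locallyOfFiniteType_field f⟩)) ∧
        Dense ((ρ ⁻¹ᵁ (W.ι ⁻¹ᵁ ⟨Scheme.regularLocus X,
          isOpen_regularLocus_of_locallyOfFiniteType_field f⟩) : Z.Opens) : Set Z) := by
  classical
  set x := φ y with hxdef
  -- (1) the other singular points form a finite set of closed points; remove them
  set T : Set X := (Scheme.regularLocus X)ᶜ \ {x} with hT
  have hTfin : T.Finite := hfin.subset Set.sdiff_subset
  have hTclosed : IsClosed T := by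
    have : T = ⋃ z ∈ T, {z} := (Set.biUnion_of_singleton T).symm
    rw [this]
    exact hTfin.isClosed_biUnion fun z hz =>
      IsolatedClosed.isClosed_singleton_of_finite_singularLocus k X f hfin hz.1
  let W₀ : X.Opens := ⟨Tᶜ, hTclosed.isOpen_compl⟩
  have hxW₀ : x ∈ W₀ := fun h => h.2 rfl
  -- (2) an affine open `U ∋ x` inside `W₀`
  obtain ⟨U, hU, hxU, hUW⟩ := exists_isAffineOpen_mem_and_subset (U := W₀) hxW₀
  haveI : Nonempty U := ⟨⟨x, hxU⟩⟩
  set ι := hU.fromSpec with hιdef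
  set 𝔭 := hU.primeIdealOf ⟨x, hxU⟩ with h𝔭def
  have hι𝔭 : ι 𝔭 = x := hU.fromSpec_primeIdealOf ⟨x, hxU⟩
  have hxcl : IsClosed ({x} : Set X) := IsolatedClosed.isClosed_singleton_of_finite_singularLocus k X f hfin hx
  haveI h𝔭max : 𝔭.asIdeal.IsMaximal := hU.primeIdealOf_isMaximal_of_isClosed ⟨x, hxU⟩ hxcl
  -- points of `Spec Γ(X,U)` other than `𝔭` are regular
  have hregB : ∀ P : Spec Γ(X, U), P.asIdeal ≠ 𝔭.asIdeal → P ∈ Scheme.regularLocus (Spec Γ(X, U)) := by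
    intro P hP
    rw [mem_regularLocus_iff_of_flat_of_isPreimmersion ι]
    have hPU : ι P ∈ U := by
      have : ι P ∈ Set.range ι := ⟨P, rfl⟩
      rwa [hιdef, hU.range_fromSpec] at this
    have hPx : ι P ≠ x := by
      intro h
      apply hP
      have : P = 𝔭 := ι.isOpenEmbedding.injective (h.trans hι𝔭.symm)
      rw [this]
    by_contra hnreg
    exact hUW hPU ⟨hnreg, hPx⟩
  -- `𝔭 ≠ 0`: otherwise `Spec Γ(X,U) = {𝔭}` and the dense regular locus would contain `x`
  have h𝔭0 : 𝔭.asIdeal ≠ ⊥ := by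
    intro h0
    have hbot : (⊥ : Ideal Γ(X, U)).IsMaximal := h0 ▸ h𝔭max
    obtain ⟨t, htU, htreg⟩ := (Scheme.dense_regularLocus X).inter_open_nonempty U U.2 ⟨x, hxU⟩
    have htr : t ∈ Set.range ι := by rw [hιdef, hU.range_fromSpec]; exact htU
    obtain ⟨P, rfl⟩ := htr
    have hP : P.asIdeal = 𝔭.asIdeal := by
      rw [h0]
      exact (hbot.eq_of_le P.isPrime.ne_top bot_le).symm
    have hP' : P = 𝔭 := PrimeSpectrum.ext hP
    rw [hP', hι𝔭] at htreg
    exact hx htreg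
  -- (3) the `k`-algebra structure of `Γ(X,U)`
  obtain ⟨gk, hgk⟩ := Spec.map_surjective (ι ≫ f)
  letI : Algebra k Γ(X, U) := gk.hom.toAlgebra
  have hιf : ι ≫ f = Spec.map (CommRingCat.ofHom (algebraMap k Γ(X, U))) := by
    rw [← hgk]; rfl
  haveI : Algebra.FiniteType k Γ(X, U) := by
    have h1 : LocallyOfFiniteType (Spec.map gk) := by rw [hgk]; infer_instance
    rw [HasRingHomProperty.Spec_iff (P := @LocallyOfFiniteType)] at h1
    exact h1
  -- (4) the chart ring: an affine open `V ∋ y` over `U`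
  have hyU : y ∈ φ ⁻¹ᵁ U := hxU
  obtain ⟨V, hV, hyV, hVU⟩ := exists_isAffineOpen_mem_and_subset (U := φ ⁻¹ᵁ U) hyU
  have e : V ≤ φ ⁻¹ᵁ U := hVU
  set ψ := φ.appLE U V e with hψdef
  have hψ : ψ.hom.Etale := φ.etale_appLE hU hV e
  letI : Algebra Γ(X, U) Γ(Y, V) := ψ.hom.toAlgebra
  haveI : Algebra.Etale Γ(X, U) Γ(Y, V) := hψ
  set 𝔔 := hV.primeIdealOf ⟨y, hyV⟩ with h𝔔def
  have hcomap : 𝔔.asIdeal.comap (algebraMap Γ(X, U) Γ(Y, V)) = 𝔭.asIdeal := by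
    have h := hU.comap_primeIdealOf_appLE (f := φ) U V hV e hyV
    exact congrArg PrimeSpectrum.asIdeal h
  haveI : 𝔔.asIdeal.LiesOver 𝔭.asIdeal := ⟨hcomap.symm⟩
  -- unramified at `𝔔`
  have hunr : 𝔭.asIdeal.map (algebraMap Γ(X, U) (Localization.AtPrime 𝔔.asIdeal)) =
      IsLocalRing.maximalIdeal (Localization.AtPrime 𝔔.asIdeal) := by
    letI := Localization.AtPrime.algebraOfLiesOver 𝔭.asIdeal 𝔔.asIdeal
    haveI : Algebra.IsUnramifiedAt Γ(X, U) 𝔔.asIdeal :=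
      (Algebra.formallyUnramified_iff_forall).mp inferInstance 𝔔
    exact ((Algebra.isUnramifiedAt_iff_map_eq Γ(X, U) 𝔭.asIdeal 𝔔.asIdeal).mp inferInstance).2
  -- (5) the stalk is the localization of the chart ring at `𝔔`: move the datum to `Γ(Y, V)_𝔔`
  letI := Y.presheaf.algebra_section_stalk (⟨y, hyV⟩ : V)
  haveI := hV.isLocalization_stalk ⟨y, hyV⟩
  let e : Localization.AtPrime 𝔔.asIdeal ≃ₐ[Γ(Y, V)] Y.presheaf.stalk y :=
    IsLocalization.algEquiv 𝔔.asIdeal.primeCompl _ _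
  obtain ⟨hfinT, hlocT⟩ := CompletedBaseChangeFibreTransport.hfin_hloc_of_ringEquiv e.symm.toRingEquiv
    ((maximalIdeal (Y.presheaf.stalk y)) ^ (a + 1)) hfin' hloc'
  -- the centre: `e⁻¹(𝔪^{a+1}) = (𝔭^{a+1} Γ(Y,V)) Γ(Y,V)_𝔔`
  have hJ : ((maximalIdeal (Y.presheaf.stalk y)) ^ (a + 1)).map
        (e.symm.toRingEquiv : Y.presheaf.stalk y →+* Localization.AtPrime 𝔔.asIdeal) =
      ((𝔭.asIdeal ^ (a + 1)).map (algebraMap Γ(X, U) Γ(Y, V))).map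
        (algebraMap Γ(Y, V) (Localization.AtPrime 𝔔.asIdeal)) := by
    rw [Ideal.map_pow, PointBlowupOfCompletion.map_maximalIdeal_ringEquiv e.symm.toRingEquiv, ← hunr, ← Ideal.map_pow,
      Ideal.map_map, ← IsScalarTower.algebraMap_eq Γ(X, U) Γ(Y, V) (Localization.AtPrime 𝔔.asIdeal)]
  rw [hJ] at hfinT hlocT
  -- (6) the ring-data form
  have hsing : ι ⟨𝔭.asIdeal, h𝔭max.isPrime⟩ ∉ Scheme.regularLocus X := by
    change ι 𝔭 ∉ _
    rw [hι𝔭]; exact hx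
  obtain ⟨W, hxW, huniq, Z, ρ, hρ, hZ, hiso, hdense⟩ :=
    hloc_of_two_step_etale_ring_data k X f ι hιf 𝔭.asIdeal h𝔭0 hsing hregB 𝔔.asIdeal hcomap a hfinT hlocT
  have hpt : ι ⟨𝔭.asIdeal, h𝔭max.isPrime⟩ = x := hι𝔭
  rw [hpt] at hxW huniq
  exact ⟨W, hxW, huniq, Z, ρ, hρ, hZ, hiso, hdense⟩

/-- ★★ **RESOLUTION WHEN EVERY SINGULAR POINT IS ÉTALE-LOCALLY RESOLVED BY TWO ROUNDS OF POINT BLOW-UPS OF THE STALK.** `X` integral,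
locally of finite type over any field, with finitely many singular points, each the image of a point `y` of an étale `X`-scheme `Y`
such that `Bl_{𝔪^{a+1}}(Spec 𝒪_{Y,y})` has finitely many singular points, each with a regular point blow-up: then `X` has a resolution of
singularities. [cite: Kollar2007, §2.2] -/
theorem hasResolution_of_isolated_etale_two_step (k : Type) [Field k] (X : Scheme.{0}) [IsIntegral X]
    (f : X ⟶ Spec (.of k)) [LocallyOfFiniteType f] (hfin : (Scheme.regularLocus X)ᶜ.Finite)
    (hchart : ∀ x : X, x ∉ Scheme.regularLocus X →
      ∃ (Y : Scheme.{0}) (φ : Y ⟶ X) (_ : Etale φ) (y : Y) (a : ℕ), φ y = x ∧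
        (Scheme.regularLocus (affineBlowup ((maximalIdeal (Y.presheaf.stalk y)) ^ (a + 1))))ᶜ.Finite ∧
        ∀ w ∈ (Scheme.regularLocus (affineBlowup ((maximalIdeal (Y.presheaf.stalk y)) ^ (a + 1))))ᶜ,
          Scheme.IsRegular (affineBlowup (maximalIdeal
            ((affineBlowup ((maximalIdeal (Y.presheaf.stalk y)) ^ (a + 1))).presheaf.stalk w)))) :
    Scheme.HasResolution X := by
  refine IsolatedGlue.hasResolution_of_finite_singularLocus_of_local k X f hfin fun s hs => ?_
  obtain ⟨Y, φ, _, y, a, hys, hfin', hloc'⟩ := hchart s hs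
  subst hys
  exact hloc_of_etale_chart_two_step k X f hfin φ y hs a hfin' hloc'

end Summit.ResolutionOfSingularities.ResolutionOfSingularities.Theorems.FRationalResolution.EtaleChartTwoStep

end
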